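import Summits.QuantumFields.QCD.Theorems.HeatSlicedQuarksRobustYangMillsHandoverFermionSliceSqrt
import Summits.QuantumFields.QCD.Theorems.QuarksAsStableActionStableActionBridgeStubFermionSliceOpSqrt
import Summits.QuantumFields.QCD.Theorems.QuarksAsStableActionStableActionBridgeStubModeNumberSelection
import HarnessLib

/-!
# A graded (fermion-number preserving) positive square root `T̂_F(U)^{1/2}`
(helper for crux stmt-QuantumFields-8892 `HeatSlicedQuarks.RobustYangMillsHandover`, line
`pin-the-infimum` — registered stub `stub_fermionSliceOp_sqrt_graded`, M1)

Smit (*Introduction to Quantum Fields on a Lattice*, §6.5 (6.87)) writes the transfer operator of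
lattice QCD with `r = 1` Wilson quarks as `T̂ = T̂_F^{1/2} T̂_U T̂_F^{1/2}`, `T̂_F(U) = fermionSliceOp U mq`
Lüscher's fermionic one-step transfer operator in the spatial background `U`.  The landed sub-goal
`fermionSliceOp_sqrt_exists` delivers a map `R : U ↦ T̂_F(U)^{1/2}` that is continuous, positive
definite, Hermitian, squares to `T̂_F(U)` and is gauge covariant.  The trace-formula chain of the line
moves one factor `R(U₀)` around the cyclic path integral past the fermion-parity twist
`Θ = diag((−1)^{#s})`, which needs ONE more property: `R(U)` preserves the fermion number,
`R(U)_{s t} = 0` whenever `#s ≠ #t`.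

Proof.  `T̂_F(U) = (det A)² · Γ(M_F(U))` and the second-quantisation functor `Γ` is block-diagonal
in the particle number, so `T̂_F(U)` commutes with the number operator `N̂ = diag(#s)` (the landed
`StubModeNumberSelection.modeNumber_comm_fermionSliceOp`).  A positive definite square root of
`T̂_F(U)` is THE non-negative square root `CFC.sqrt (T̂_F(U))` (`CFC.sqrt_unique`), which lies in the
bicommutant of `T̂_F(U)` (the landed `StubFermionSliceOpSqrt.commute_cfcSqrt`, i.e. Mathlib's
`Commute.cfc_nnreal`); hence `R(U)` commutes with `N̂`, i.e. `(#s − #t) R(U)_{s t} = 0`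
(`StubScalarKernelProps.diagonal_mul_eq_mul_diagonal_iff`).

References: J. Smit, *Introduction to Quantum Fields on a Lattice*, §6.5 (6.87) [Smit2023];
M. Lüscher, Commun. Math. Phys. 54 (1977) 283 [Luscher1977, pp. 283–292].  Pure theorem file
(no definitions); the generic lemma lives in the sub-namespace `StubFermionSliceSqrtGraded`.
-/

noncomputable section

namespace Summit.QuantumFields.QCD.Cruxes.RobustYangMillsHandover.PinTheInfimum

open MeasureTheory Filter Function Matrix
open Literature.MathematicalPhysics.QuantumFieldTheory Literature.MathematicalPhysics.QuantumLattice
open Literature.Probability.LatticeModels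
open Summit.QuantumFields.QCD.Cruxes.StableActionBridge.TwistedTraceTransfer.StubFermionSliceOpSqrt
  (commute_cfcSqrt)
open Summit.QuantumFields.QCD.Cruxes.StableActionBridge.TwistedTraceTransfer.StubScalarKernelProps
  (diagonal_mul_eq_mul_diagonal_iff)
open Summit.QuantumFields.QCD.Cruxes.StableActionBridge.TwistedTraceTransfer.StubModeNumberSelection
  (modeNumber_comm_fermionSliceOp)
open scoped ComplexOrder MatrixOrder

namespace StubFermionSliceSqrtGraded

variable {Nf S : ℕ} [NeZero S]

/-- **A positive definite square root of `T̂_F(U)` preserves the fermion number**: if `B ≥ 0` and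
`B² = T̂_F(U)` then `B = CFC.sqrt (T̂_F(U))` commutes with the number operator, so `B_{s t} = 0`
for `#s ≠ #t`. [cite: Luscher1977, pp. 283–292] -/
theorem sqrt_apply_of_card_ne (U : GaugeConfig 3 S (Matrix.specialUnitaryGroup (Fin 3) ℂ))
    (mq : Fin Nf → ℝ) {B : Matrix (Finset (SliceFermiIdx Nf S)) (Finset (SliceFermiIdx Nf S)) ℂ}
    (hB : B.PosSemidef) (hsq : B * B = fermionSliceOp U mq) {s t : Finset (SliceFermiIdx Nf S)}
    (h : s.card ≠ t.card) : B s t = 0 := by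
  have hBe : CFC.sqrt (fermionSliceOp U mq) = B := CFC.sqrt_unique hsq hB.nonneg
  have hc := commute_cfcSqrt (modeNumber_comm_fermionSliceOp U mq)
  rw [hBe] at hc
  exact (diagonal_mul_eq_mul_diagonal_iff _ _).1 hc s t (by exact_mod_cast h)

end StubFermionSliceSqrtGraded

/-- **Registered stub `stub_fermionSliceOp_sqrt_graded` of line `pin-the-infimum`: a GRADED
continuous positive covariant square root `R(U) = T̂_F(U)^{1/2}` of Lüscher's fermionic transfer
operator** (the factor of Smit's `T̂ = T̂_F^{1/2} T̂_U T̂_F^{1/2}`).  For all bare masses `m_f > −1`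
there is a map `R` on the `SU(3)` backgrounds of the spatial three-torus, continuous in `U`, positive
definite and Hermitian at every `U`, with `R(U)² = T̂_F(U) = fermionSliceOp U mq`, gauge covariant
`R(U^g) = Γ(G_g) R(U) Γ(G_g)ᴴ`, AND preserving the fermion number: `R(U)_{s t} = 0` if `#s ≠ #t`.
The first five properties are the landed `fermionSliceOp_sqrt_exists`; the grading is
`StubFermionSliceSqrtGraded.sqrt_apply_of_card_ne` (uniqueness of the non-negative square root and
`Commute.cfc_nnreal`). [cite: Smit2023, §6.5 (6.87)] -/
theorem stub_fermionSliceOp_sqrt_graded :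
    ∀ (Nf S : ℕ) [NeZero S] (mq : Fin Nf → ℝ), (∀ f, -1 < mq f) →
      ∃ R : GaugeConfig 3 S (Matrix.specialUnitaryGroup (Fin 3) ℂ) →
          Matrix (Finset (SliceFermiIdx Nf S)) (Finset (SliceFermiIdx Nf S)) ℂ,
        Continuous R ∧ (∀ U, (R U).PosDef) ∧ (∀ U, (R U)ᴴ = R U) ∧ (∀ U, R U * R U = fermionSliceOp U mq) ∧
          (∀ (g : TorusSite 3 S → Matrix.specialUnitaryGroup (Fin 3) ℂ)
            (U : GaugeConfig 3 S (Matrix.specialUnitaryGroup (Fin 3) ℂ)),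
            R (gaugeTransform g U) = fockGaugeAct g * R U * (fockGaugeAct g)ᴴ) ∧
          ∀ (U : GaugeConfig 3 S (Matrix.specialUnitaryGroup (Fin 3) ℂ)) (s t : Finset (SliceFermiIdx Nf S)),
            s.card ≠ t.card → R U s t = 0 := by
  intro Nf S _ mq hm
  obtain ⟨R, hRc, hRpd, hRh, hRsq, hRcov⟩ := fermionSliceOp_sqrt_exists Nf S mq hm
  exact ⟨R, hRc, hRpd, hRh, hRsq, hRcov, fun U _ _ hst =>
    StubFermionSliceSqrtGraded.sqrt_apply_of_card_ne U mq (hRpd U).posSemidef (hRsq U) hst⟩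

end Summit.QuantumFields.QCD.Cruxes.RobustYangMillsHandover.PinTheInfimum

end
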